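import Literature.AlgebraicGeometry.Frobenioids.PerfectionCoAngularPreSteps
import HarnessLib

/-!
# Frobenioids I, Proposition 3.2 (iii) "`C^pf` is a Frobenioid": Definition 1.3 (iii)(c), second clause,
# for the perfection — the transport of `O^▷` depends only on `Base(φ)` (PROOFS)

Mochizuki, *The geometry of Frobenioids I: the general theory*, Kyushu J. Math. **62** (2008)
293–400, Definition 1.3 (iii)(c) p. 24 ("a uniquely determined bijection … depending only on `Base(φ)`"),
Proposition 3.2 (iii) p. 59 [cite: MochizukiFrdI2008, Prop. 3.2 (iii) p.59].

PROOF-ONLY sequel of `PerfectionCoAngularPreSteps.lean` (row `FrdI:Prop3.2(iii)-frobenioid`, Def. 1.3 (iii)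
pieces, seat abc-iut-w5-d246): for `C` of Frobenius-isotropic type, two co-angular pre-steps
`φ, φ' : (A, n) → (B, m)` of `C^pf` with `Base(φ) = Base(φ')`, an `α ∈ O^▷((A, n))` and intertwiners
`β, β' ∈ O^▷((B, m))` (`φ ≫ β = α ≫ φ`, `φ' ≫ β' = α ≫ φ'`) have `β = β'` — the field `iii_c_base` of the
cell's `IsFrobenioid` for the operations `Perfection.ops hF`.  Printed argument made explicit:
representatives `ρ₁, ρ₂` of `φ, φ'`, `θ` of `α`, `η₁, η₂` of `β, β'` are transported to ONE common level
`(N_a, N_b)` at which (after a further enlargement, the classes being inductive-limit classes) both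
intertwining relations hold on the nose in `C`, the two representatives have the same `Base` and are
co-angular pre-steps of `C` (isotropic domain, `isCoAngularPreStep_of_isPreStep_frobPow`); Def. 1.3
(iii)(c) of `C` ("depends only on `Base(φ)`", `IsFrobenioid.iii_c_base`) then identifies the transported
`η₁, η₂`, whose classes are `β, β'`.  No new definitions; nothing here is specific to the abc programme.
-/

namespace Literature.AlgebraicGeometry.Frobenioids

namespace PreFrobenioid

namespace Perfection

open CategoryTheory Opposite

universe w v v' u u'

variable {D : Type u} [Category.{v} D] {Φ : Dᵒᵖ ⥤ CommMonCat.{w}}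
  {C : Type u'} [Category.{v'} C] {F : C ⥤ ElemFrobenioid Φ} {hF : IsFrobenioid F}

/-! ### Intertwining relations: from classes to a common level, and upwards -/

/-- An on-the-nose intertwining relation `ρ ≫ η = θ ≫ ρ` in `C` persists after transport to a higher level
(Prop. 1.10 (i) transport is compatible with composition). [cite: MochizukiFrdI2008, Prop. 1.10 (i) p.34] -/
theorem rel_liftLevel {A B : C} {a b a' b' : ℕ+} {ρ : frobPow hF A a ⟶ frobPow hF B b}
    {θ : frobPow hF A a ⟶ frobPow hF A a} {η : frobPow hF B b ⟶ frobPow hF B b} (h : ρ ≫ η = θ ≫ ρ)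
    (ha : a ∣ a') (hb : b ∣ b') (hd : degFr F (frobTrans hF A ha) = degFr F (frobTrans hF B hb)) :
    liftLevel hF ρ ha hb hd ≫ liftLevel hF η hb hb rfl = liftLevel hF θ ha ha rfl ≫ liftLevel hF ρ ha hb hd := by
  rw [← liftLevel_comp hF ρ η ha hb hb hd rfl, ← liftLevel_comp hF θ ρ ha ha hb rfl hd, h]

/-- A single-lift intertwining relation at exponents `(a', b')` — among the transports of `ρ : A^{(a)} →
B^{(b)}`, `θ ∈ End(A^{(c)})`, `η ∈ End(B^{(c')})` — persists at any higher exponents `(a'', b'')`.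
[cite: MochizukiFrdI2008, Prop. 1.10 (i) p.34] -/
theorem rel_liftLevel_trans {A B : C} {a b c c' a' b' a'' b'' : ℕ+} {ρ : frobPow hF A a ⟶ frobPow hF B b}
    {θ : frobPow hF A c ⟶ frobPow hF A c} {η : frobPow hF B c' ⟶ frobPow hF B c'}
    (ha : a ∣ a') (hb : b ∣ b') (hc : c ∣ a') (hc' : c' ∣ b')
    (hd : degFr F (frobTrans hF A ha) = degFr F (frobTrans hF B hb))
    (h : liftLevel hF ρ ha hb hd ≫ liftLevel hF η hc' hc' rfl =
      liftLevel hF θ hc hc rfl ≫ liftLevel hF ρ ha hb hd)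
    (ha' : a' ∣ a'') (hb' : b' ∣ b'') (hd' : degFr F (frobTrans hF A ha') = degFr F (frobTrans hF B hb'))
    (hd'' : degFr F (frobTrans hF A (ha.trans ha')) = degFr F (frobTrans hF B (hb.trans hb'))) :
    liftLevel hF ρ (ha.trans ha') (hb.trans hb') hd'' ≫ liftLevel hF η (hc'.trans hb') (hc'.trans hb') rfl =
      liftLevel hF θ (hc.trans ha') (hc.trans ha') rfl ≫ liftLevel hF ρ (ha.trans ha') (hb.trans hb') hd'' := by
  have e := rel_liftLevel h ha' hb' hd'
  rw [liftLevel_trans hF ρ ha hb hd ha' hb' hd' hd'', liftLevel_trans hF η hc' hc' rfl hb' hb' rfl rfl,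
    liftLevel_trans hF θ hc hc rfl ha' ha' rfl rfl] at e
  exact e

/-- From an intertwining relation between CLASSES, `[ρ] ≫ [η] = [θ] ≫ [ρ]` in `C^pf`, at an aligned level
`N` (all exponents dividing those of `N`), to an on-the-nose relation in `C` among the transports at some
higher level `M ≥ N` (the classes are inductive-limit classes). [cite: MochizukiFrdI2008, Def. 3.1 (ii) p.56] -/
theorem exists_level_of_rel {X Y : Perfection hF} {a b c c' : ℕ+} (hab : X.idx * a = Y.idx * b)
    (ρ : frobPow hF X.obj a ⟶ frobPow hF Y.obj b) (θ : frobPow hF X.obj c ⟶ frobPow hF X.obj c)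
    (η : frobPow hF Y.obj c' ⟶ frobPow hF Y.obj c') (N : Level X Y)
    (hN : Level.LE (⟨a, b, hab⟩ : Level X Y) N) (hc : c ∣ N.a) (hc' : c' ∣ N.b)
    (h : Hom.mk (⟨⟨a, b, hab⟩, ρ⟩ : Rep X Y) ≫ endClass Y c' η =
      endClass X c θ ≫ Hom.mk (⟨⟨a, b, hab⟩, ρ⟩ : Rep X Y)) :
    ∃ (M : Level X Y) (hM : N.LE M)
      (hd : degFr F (frobTrans hF X.obj (hN.1.trans hM.1)) = degFr F (frobTrans hF Y.obj (hN.2.trans hM.2))),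
      liftLevel hF ρ (hN.1.trans hM.1) (hN.2.trans hM.2) hd ≫
          liftLevel hF η (hc'.trans hM.2) (hc'.trans hM.2) rfl =
        liftLevel hF θ (hc.trans hM.1) (hc.trans hM.1) rfl ≫
          liftLevel hF ρ (hN.1.trans hM.1) (hN.2.trans hM.2) hd := by
  obtain ⟨Na, Nb, hNab⟩ := N
  -- rewrite the relation at the level `N`
  rw [← Hom.mk_lift (⟨⟨a, b, hab⟩, ρ⟩ : Rep X Y) ⟨Na, Nb, hNab⟩ hN, ← endClass_liftLevel Y hc' η rfl,
    ← endClass_liftLevel X hc θ rfl] at h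
  change Hom.mk (⟨⟨Na, Nb, hNab⟩, _⟩ : Rep X Y) ≫ endClass Y Nb _ =
    endClass X Na _ ≫ Hom.mk (⟨⟨Na, Nb, hNab⟩, _⟩ : Rep X Y) at h
  rw [mk_comp_endClass, endClass_comp_mk] at h
  obtain ⟨M, h₁, h₂, e⟩ := Hom.mk_eq_mk.mp h
  refine ⟨M, h₁, Level.degFr_eq _ M (hN.trans h₁), ?_⟩
  -- expand the transported composites and collapse the double transports
  have e₁ := liftLevel_comp hF (Level.lift (⟨a, b, hab⟩ : Level X Y) ⟨Na, Nb, hNab⟩ hN ρ)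
    (liftLevel hF η hc' hc' rfl) h₁.1 h₁.2 h₁.2 (Level.degFr_eq _ M h₁) rfl
  have e₂ := liftLevel_comp hF (liftLevel hF θ hc hc rfl)
    (Level.lift (⟨a, b, hab⟩ : Level X Y) ⟨Na, Nb, hNab⟩ hN ρ) h₁.1 h₁.1 h₁.2 rfl (Level.degFr_eq _ M h₁)
  have e' := e₁.symm.trans (e.trans e₂)
  change liftLevel hF (liftLevel hF ρ hN.1 hN.2 _) h₁.1 h₁.2 _ ≫ _ =
    _ ≫ liftLevel hF (liftLevel hF ρ hN.1 hN.2 _) h₁.1 h₁.2 _ at e'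
  rw [liftLevel_trans hF ρ hN.1 hN.2 _ h₁.1 h₁.2 _ (Level.degFr_eq _ M (hN.trans h₁)),
    liftLevel_trans hF η hc' hc' rfl h₁.2 h₁.2 rfl rfl, liftLevel_trans hF θ hc hc rfl h₁.1 h₁.1 rfl rfl] at e'
  exact e'

/-! ### Definition 1.3 (iii)(c), second clause, for `C^pf` -/

/-- **Def. 1.3 (iii)(c), second clause, for `C^pf`** (for `C` of Frobenius-isotropic type): the bijection
`O^▷(X) ⥲ O^▷(Y)` induced by a co-angular pre-step `φ : X → Y` of `C^pf` depends only on `Base(φ)` —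
if `φ, φ'` are co-angular pre-steps with `Base(φ) = Base(φ')` and `φ ≫ β = α ≫ φ`, `φ' ≫ β' = α ≫ φ'`,
then `β = β'`. [cite: MochizukiFrdI2008, Prop. 3.2 (iii) p.59] -/
theorem iii_c_base_perfection (hiso : IsOfType (IsFrobeniusIsotropic F)) ⦃X Y : Perfection hF⦄
    (φ φ' : X ⟶ Y) (hφ : (ops hF).IsCoAngularPreStep φ) (hφ' : (ops hF).IsCoAngularPreStep φ')
    (hb : (ops hF).base.map φ = (ops hF).base.map φ') (α : (ops hF).endSubmonoid X)
    (β β' : (ops hF).endSubmonoid Y)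
    (h : φ ≫ (show Y ⟶ Y from β.1) = (show X ⟶ X from α.1) ≫ φ)
    (h' : φ' ≫ (show Y ⟶ Y from β'.1) = (show X ⟶ X from α.1) ≫ φ') : β = β' := by
  obtain ⟨⟨⟨a₁, b₁, hab₁⟩, ρ₁⟩, rfl⟩ := Hom.mk_surjective φ
  obtain ⟨⟨⟨a₂, b₂, hab₂⟩, ρ₂⟩, rfl⟩ := Hom.mk_surjective φ'
  have hρ₁ : IsPreStep F ρ₁ := (isPreStep_mk_iff (⟨⟨a₁, b₁, hab₁⟩, ρ₁⟩ : Rep X Y)).mp hφ.2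
  have hρ₂ : IsPreStep F ρ₂ := (isPreStep_mk_iff (⟨⟨a₂, b₂, hab₂⟩, ρ₂⟩ : Rep X Y)).mp hφ'.2
  obtain ⟨c, θ, rfl⟩ := exists_endSubmonoidClassHom_eq X α
  obtain ⟨c₁, η₁, rfl⟩ := exists_endSubmonoidClassHom_eq Y β
  obtain ⟨c₂, η₂, rfl⟩ := exists_endSubmonoidClassHom_eq Y β'
  obtain ⟨A', φ₀, hφ₀, hA'⟩ := hiso X.obj
  change Hom.mk _ ≫ endClass Y c₁ (End.asHom η₁.1) = endClass X c (End.asHom θ.1) ≫ Hom.mk _ at h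
  change Hom.mk _ ≫ endClass Y c₂ (End.asHom η₂.1) = endClass X c (End.asHom θ.1) ≫ Hom.mk _ at h'
  -- ONE aligned level `N` for both relations: the sup of the two levels, scaled by `s = c·c₁·c₂·deg φ₀`
  have hcs : c ∣ a₁ * a₂ * (c * (c₁ * (c₂ * PreFrobenioid.degFr F φ₀))) :=
    (dvd_mul_right c _).mul_left _
  have hc₁s : c₁ ∣ b₁ * a₂ * (c * (c₁ * (c₂ * PreFrobenioid.degFr F φ₀))) :=
    ((dvd_mul_right c₁ _).mul_left c).mul_left _
  have hc₂s : c₂ ∣ b₁ * a₂ * (c * (c₁ * (c₂ * PreFrobenioid.degFr F φ₀))) :=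
    (((dvd_mul_right c₂ _).mul_left c₁).mul_left c).mul_left _
  have hds : PreFrobenioid.degFr F φ₀ ∣ a₁ * a₂ * (c * (c₁ * (c₂ * PreFrobenioid.degFr F φ₀))) :=
    (((dvd_mul_left _ c₂).mul_left c₁).mul_left c).mul_left _
  generalize c * (c₁ * (c₂ * PreFrobenioid.degFr F φ₀)) = s at hcs hc₁s hc₂s hds
  have hsup := (Level.b_mul_a (⟨a₁, b₁, hab₁⟩ : Level X Y) ⟨a₂, b₂, hab₂⟩)
  change b₁ * a₂ = a₁ * b₂ at hsup
  have hN : X.idx * (a₁ * a₂ * s) = Y.idx * (b₁ * a₂ * s) := by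
    rw [← mul_assoc, ← mul_assoc, ← mul_assoc, ← mul_assoc, hab₁]
  have h₁N : Level.LE (⟨a₁, b₁, hab₁⟩ : Level X Y) ⟨a₁ * a₂ * s, b₁ * a₂ * s, hN⟩ :=
    ⟨(dvd_mul_right a₁ a₂).mul_right s, (dvd_mul_right b₁ a₂).mul_right s⟩
  have h₂N : Level.LE (⟨a₂, b₂, hab₂⟩ : Level X Y) ⟨a₁ * a₂ * s, b₁ * a₂ * s, hN⟩ :=
    ⟨(dvd_mul_left a₂ a₁).mul_right s, (Dvd.intro a₁ (by rw [mul_comm b₂ a₁, hsup])).mul_right s⟩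
  -- both relations on the nose at higher levels `M₁, M₂ ≥ N`
  obtain ⟨M₁, hM₁, hd₁, r₁⟩ := exists_level_of_rel hab₁ ρ₁ (End.asHom θ.1) (End.asHom η₁.1)
    ⟨a₁ * a₂ * s, b₁ * a₂ * s, hN⟩ h₁N hcs hc₁s h
  obtain ⟨M₂, hM₂, hd₂, r₂⟩ := exists_level_of_rel hab₂ ρ₂ (End.asHom θ.1) (End.asHom η₂.1)
    ⟨a₁ * a₂ * s, b₁ * a₂ * s, hN⟩ h₂N hcs hc₂s h'
  -- … and at their common upper level `P`
  have h₁P : M₁.LE (M₁.sup M₂) := Level.le_sup_left _ _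
  have h₂P : M₂.LE (M₁.sup M₂) := Level.le_sup_right _ _
  generalize M₁.sup M₂ = P at h₁P h₂P
  have R₁ := rel_liftLevel_trans _ _ _ _ hd₁ r₁ h₁P.1 h₁P.2 (Level.degFr_eq _ _ h₁P)
    (Level.degFr_eq (⟨a₁, b₁, hab₁⟩ : Level X Y) P (h₁N.trans (hM₁.trans h₁P)))
  have R₂ := rel_liftLevel_trans _ _ _ _ hd₂ r₂ h₂P.1 h₂P.2 (Level.degFr_eq _ _ h₂P)
    (Level.degFr_eq (⟨a₂, b₂, hab₂⟩ : Level X Y) P (h₂N.trans (hM₂.trans h₂P)))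
  -- the data at the level `P`
  have hcP : c ∣ P.a := hcs.trans (hM₁.1.trans h₁P.1)
  have hdP : PreFrobenioid.degFr F φ₀ ∣ P.a := hds.trans (hM₁.1.trans h₁P.1)
  have hc₁P : c₁ ∣ P.b := hc₁s.trans (hM₁.2.trans h₁P.2)
  have hc₂P : c₂ ∣ P.b := hc₂s.trans (hM₂.2.trans h₂P.2)
  have hL₁P : Level.LE (⟨a₁, b₁, hab₁⟩ : Level X Y) P := h₁N.trans (hM₁.trans h₁P)
  have hL₂P : Level.LE (⟨a₂, b₂, hab₂⟩ : Level X Y) P := h₂N.trans (hM₂.trans h₂P)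
  change Level.lift (⟨a₁, b₁, hab₁⟩ : Level X Y) P hL₁P ρ₁ ≫ liftLevel hF (End.asHom η₁.1) hc₁P hc₁P rfl =
    liftLevel hF (End.asHom θ.1) hcP hcP rfl ≫ Level.lift (⟨a₁, b₁, hab₁⟩ : Level X Y) P hL₁P ρ₁ at R₁
  change Level.lift (⟨a₂, b₂, hab₂⟩ : Level X Y) P hL₂P ρ₂ ≫ liftLevel hF (End.asHom η₂.1) hc₂P hc₂P rfl =
    liftLevel hF (End.asHom θ.1) hcP hcP rfl ≫ Level.lift (⟨a₂, b₂, hab₂⟩ : Level X Y) P hL₂P ρ₂ at R₂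
  -- the two transported representatives: co-angular pre-steps of `C` with the same `Base`
  have hS₁ : IsCoAngularPreStep F (Level.lift (⟨a₁, b₁, hab₁⟩ : Level X Y) P hL₁P ρ₁) :=
    isCoAngularPreStep_of_isPreStep_frobPow hφ₀ hA' hdP
      ((isPreStep_lift_iff (⟨⟨a₁, b₁, hab₁⟩, ρ₁⟩ : Rep X Y) P hL₁P).mpr hρ₁)
  have hS₂ : IsCoAngularPreStep F (Level.lift (⟨a₂, b₂, hab₂⟩ : Level X Y) P hL₂P ρ₂) :=
    isCoAngularPreStep_of_isPreStep_frobPow hφ₀ hA' hdP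
      ((isPreStep_lift_iff (⟨⟨a₂, b₂, hab₂⟩, ρ₂⟩ : Rep X Y) P hL₂P).mpr hρ₂)
  have hbase : Base F (Level.lift (⟨a₁, b₁, hab₁⟩ : Level X Y) P hL₁P ρ₁) =
      Base F (Level.lift (⟨a₂, b₂, hab₂⟩ : Level X Y) P hL₂P ρ₂) := by
    rw [base_hom_eq (⟨P, _⟩ : Rep X Y), base_hom_eq (⟨P, _⟩ : Rep X Y)]
    change baseInvFrob hF X.obj P.a ≫ Rep.baseMap ⟨P, Level.lift _ P hL₁P ρ₁⟩ ≫ Base F (frob hF Y.obj P.b) =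
      baseInvFrob hF X.obj P.a ≫ Rep.baseMap ⟨P, Level.lift _ P hL₂P ρ₂⟩ ≫ Base F (frob hF Y.obj P.b)
    rw [baseMap_lift, baseMap_lift]
    exact congrArg (fun k => baseInvFrob hF X.obj P.a ≫ k ≫ Base F (frob hF Y.obj P.b)) hb
  -- the transported endomorphisms lie in `O^▷`
  have hΘ : End.of (liftLevel hF (End.asHom θ.1) hcP hcP rfl) ∈ endSubmonoid F (frobPow hF X.obj P.a) :=
    (liftLevel_mem_iff X hcP θ.1 rfl).mpr θ.2
  have hH₁ : End.of (liftLevel hF (End.asHom η₁.1) hc₁P hc₁P rfl) ∈ endSubmonoid F (frobPow hF Y.obj P.b) :=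
    (liftLevel_mem_iff Y hc₁P η₁.1 rfl).mpr η₁.2
  have hH₂ : End.of (liftLevel hF (End.asHom η₂.1) hc₂P hc₂P rfl) ∈ endSubmonoid F (frobPow hF Y.obj P.b) :=
    (liftLevel_mem_iff Y hc₂P η₂.1 rfl).mpr η₂.2
  -- Def. 1.3 (iii)(c) of `C`: "depending only on `Base(φ)`"
  have key := hF.iii_c_base _ _ hS₁ hS₂ hbase ⟨_, hΘ⟩ ⟨_, hH₁⟩ ⟨_, hH₂⟩ R₁ R₂
  have key' : liftLevel hF (End.asHom η₁.1) hc₁P hc₁P rfl = liftLevel hF (End.asHom η₂.1) hc₂P hc₂P rfl :=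
    congrArg (fun x => End.asHom x.1) key
  -- conclude on classes
  rw [← endSubmonoidClassHom_liftLevel Y hc₁P η₁ rfl, ← endSubmonoidClassHom_liftLevel Y hc₂P η₂ rfl]
  exact congrArg _ (Subtype.ext (congrArg End.of key'))

end Perfection

end PreFrobenioid

end Literature.AlgebraicGeometry.Frobenioids
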